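import Summits.HodgeConjecture.CorCM.PairFlipSexticFourCoreTransfer
import Summits.HodgeConjecture.CorCM.NonGaloisSexticCMFrame
import HarnessLib

/-!
# COR-CM — pair-flip sextic CM fields: the Hodge conjecture in CODIMENSION 2 for `X₀ × X₁ × X₂ × X₃` implies the
# Hodge conjecture in every codimension for every product of powers `X₀^a × X₁^b × X₂^c × X₃^d` (frame form)

Cell `pub-hodgecm2` (COR-CM), binder seat b25 (gen 37); COUNT-NEUTRAL own lane (W-b of B01-SIZE §4 T2); theorems only, no
definition, no named fact, no `sorry`.  Sequel of `CorCM/PairFlipSexticFourCoreTransfer.lean`, whose hypothesis `hface`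
(the weight lines of the six face weights of `Y = ⨁ A₄ = X₀ × X₁ × X₂ × X₃` are algebraic) is DISCHARGED here from the
intrinsic statement «every rational `(2,2)`-class of `Y` is algebraic» (HC for `Y` in codimension 2):

* `isGaloisBalancedAlg_of_image_eq_face` — a face weight is `Aut(ℂ)`-balanced for the CM algebra `K⁴` (every
  `τ ∈ Aut(ℂ)` acts on the two embeddings `s, s̄` over the face's place like one of the 24 model maps
  `act j false (c,c,c)`, because `τ ∘ s̄ = (τ ∘ s)‾` on a CM field — `NonGaloisField.comp_conjugate` — and the face is
  balanced for those, `Census.PairFlipSexticFourCore.gens_balanced`); hence its weight line lies in `B²(Y) ⊗ ℂ`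
  (`Pohlmann1968.weightClassesAlg_le_hodgeClassSpan`, Gao–Ullmo Thm 3.1).
* `hface_of_hodgeClasses_two` — HC²(`Y`) ⟹ `hface`.
* **`hodgeConjectureFor_biproduct_comp_of_hodgeClasses_two`**, **`hodgeConjectureFor_of_avDominatedBy_comp_of_hodgeClasses_two`**
  — for a CM field `K` in a pair-flip frame (`he_conj`, `he_gal`) with the four CM types read by the model (`hΦ`) and
  realisations `A₄ b ⊨ (K; Φ₄ b)`: **if every rational `(2,2)`-class of the 12-fold `X₀ × X₁ × X₂ × X₃` is algebraic,
  then the Hodge conjecture holds for `⨁_j A₄ (κ j)` for EVERY slot map `κ` (all products of powers) and for every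
  abelian variety dominated by such a power.**  Conversely HC²(`Y`) is an instance of the conclusion (`κ = id`).
For the stage-1 (PerL) field class this is the promised one-line reduction: HC for the whole CM class of `K` ⟺ ONE
codimension-2 statement on ONE 12-fold, whose exceptional part is the rank-6 face species (`B²(Y) = D²(Y) ⊕` faces,
oracle count `72 = 66 + 6`).  HONEST FRAMING: conditional; `HC_CM`, `PerL`, `PerLFace` are neither used nor proved.
[cite: Pohlmann1968, Thm 1] [cite: GaoUllmo2025, Thm 3.1] [cite: Milne2020HodgeClassesAV, 1.2 (a) and Thm. 1]
[cite: Shimura1998, §18.2 Lemma (i)]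

## References
* [Pohlmann1968] H. Pohlmann, Ann. of Math. 88 (1968), Thm 1.  [GaoUllmo2025] Z. Gao, E. Ullmo, J. Inst. Math. Jussieu
  25 (2025), Thm 3.1.  [Milne2020HodgeClassesAV] J. S. Milne, arXiv:2010.08857.  [Shimura1998] G. Shimura, *Abelian
  Varieties with Complex Multiplication and Modular Functions*, §18.2 Lemma (i).
-/

noncomputable section

open CategoryTheory CategoryTheory.Limits NumberField

namespace Summit.HodgeConjecture.CorCM.PairFlipSexticFourCore

open Literature.AlgebraicGeometry Literature.AlgebraicGeometry.Motives Literature.AlgebraicGeometry.HodgeTheory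
open Literature.AlgebraicGeometry.ComplexMultiplication (IsCMTypeRealisation)
open Literature.AlgebraicGeometry.Pohlmann1968
open Literature.AlgebraicGeometry.VanGeemen1994 (hodgeClassSpan)
open Literature.AlgebraicTopology.SingularHomology
open Literature.NumberTheory.ComplexMultiplication
open Summit.HodgeConjecture.CorCM.NonGaloisField (comp_conjugate)
open Summit.HodgeConjecture.CorCM.Census.PairFlipSexticFourCore (Pt act phi conjPair face gens flipAt act_apply act_conj
  mem_gens_iff mem_conjPair_iff mem_face_iff gens_balanced isCMType_phi balanced_of_mem_gens balanced₂₄)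
open Summit.HodgeConjecture.CorCM.Census.PairFlipSexticFourCorePowers (card_filter_comp_eq_card_filter_image_of_injOn)
open Summit.HodgeConjecture.CorCM.DihedralSexticPairCurvePowers (ncard_sep_eq_card_filter)

open scoped Classical Pointwise

/-! ## §1 Face weights are Galois-balanced -/

section Face

variable {K : Type} [Field K] [NumberField K] [IsCMField K] {e : (K →+* ℂ) ≃ ZMod 3 × Bool}
  (he_conj : ∀ s : K →+* ℂ, e (ComplexEmbedding.conjugate s) = ((e s).1, !(e s).2))
  {Φ₄ : Fin 4 → CMType K}
  (hΦ : ∀ (b : Fin 4) (s : K →+* ℂ), s ∈ (Φ₄ b).1 ↔ ((b, (e s).1, (e s).2) : Pt) ∈ phi)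

/-- `act j false (c, c, c)` rotates the place by `j` and flips every sign iff `c`. [folklore] -/
theorem act_false_const_apply (j : ZMod 3) (c : Bool) (b : Fin 4) (i : ZMod 3) (s : Bool) :
    act j false (c, c, c) (b, i, s) = (b, i + j, xor s c) := by
  rw [act_false_apply]
  have h : flipAt (c, c, c) (i + j) = c := by unfold flipAt; split_ifs <;> rfl
  rw [h]

include he_conj in
/-- In the frame, `Aut(ℂ)` commutes with the sign flip: `e (τ ∘ e⁻¹(i, ¬s)) = (place, ¬sign)` of `e (τ ∘ e⁻¹(i, s))`
(complex conjugation of a CM field commutes with every automorphism of `ℂ` on its embeddings).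
[cite: Shimura1998, §18.2 Lemma (i)] -/
theorem frame_comp_symm_not (τ : ℂ ≃+* ℂ) (i : ZMod 3) (s : Bool) :
    e ((τ : ℂ →+* ℂ).comp (e.symm (i, !s))) =
      ((e ((τ : ℂ →+* ℂ).comp (e.symm (i, s)))).1, !(e ((τ : ℂ →+* ℂ).comp (e.symm (i, s)))).2) := by
  have hsymm : e.symm (i, !s) = ComplexEmbedding.conjugate (e.symm (i, s)) := by
    apply e.injective
    rw [Equiv.apply_symm_apply, he_conj, Equiv.apply_symm_apply]
  rw [hsymm, comp_conjugate, he_conj]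

include he_conj hΦ in
/-- **A face weight is `Aut(ℂ)`-balanced** for the CM algebra `K⁴` with types `Φ₄`: for `τ ∈ Aut(ℂ)` let
`(i', s') = e (τ ∘ e⁻¹(i, sg))`; on the face over the place `i` the action of `τ` coincides with the model map
`act (i' − i) false (c, c, c)`, `c = s' ⊻ sg`, for which the face is balanced (`gens_balanced`).
[cite: GaoUllmo2025, Thm 3.1 (3.2)] [cite: Pohlmann1968, Thm 1] -/
theorem isGaloisBalancedAlg_of_image_eq_face {T : Finset ((_ : Fin 4) × (K →+* ℂ))} {i : ZMod 3} {sg : Bool}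
    (hT : T.image (toPt e) = face i sg) : IsGaloisBalancedAlg (K := fun _ : Fin 4 => K) Φ₄ T := by
  intro τ
  -- the permutation of the frame induced by `τ`
  set g : ZMod 3 × Bool → ZMod 3 × Bool := fun y => e ((τ : ℂ →+* ℂ).comp (e.symm y)) with hg
  have hgτ : ∀ s : K →+* ℂ, e ((τ : ℂ →+* ℂ).comp s) = g (e s) := fun s => by
    rw [hg]; simp only [Equiv.symm_apply_apply]
  -- membership read in the model through `g`
  have key : ∀ x : (_ : Fin 4) × (K →+* ℂ), (τ : ℂ →+* ℂ).comp x.2 ∈ (Φ₄ x.1).1 ↔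
      ((toPt e x).1, g (toPt e x).2) ∈ phi := by
    rintro ⟨b, s⟩
    simp only [toPt_mk, hΦ, hgτ, Prod.mk.eta]
  -- name `(i', s') = g (i, sg)` and the common sign twist `c`
  obtain ⟨⟨i', s'⟩, hy⟩ : ∃ y, g (i, sg) = y := ⟨_, rfl⟩
  set c : Bool := xor s' sg with hc
  have hflip : g (i, !sg) = (i', !s') := by
    have h := frame_comp_symm_not he_conj τ i sg
    change g (i, !sg) = ((g (i, sg)).1, !(g (i, sg)).2) at h
    rw [h, hy]
  have hsg : xor sg c = s' := by rw [hc]; cases sg <;> cases s' <;> rfl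
  have hnsg : xor (!sg) c = !s' := by rw [hc]; cases sg <;> cases s' <;> rfl
  have hij : i + (i' - i) = i' := by ring
  -- on the face, `g` acts like `act (i' - i) false (c, c, c)`
  have onface : ∀ y ∈ face i sg, ((y.1, g y.2) ∈ phi ↔ act (i' - i) false (c, c, c) y ∈ phi) := by
    intro y hyf
    rcases (mem_face_iff i sg y).1 hyf with rfl | rfl | rfl | rfl
    · rw [act_false_const_apply, hij, hsg]; change ((0 : Fin 4), g (i, sg)) ∈ phi ↔ _; rw [hy]
    · rw [act_false_const_apply, hij, hnsg]; change ((1 : Fin 4), g (i, !sg)) ∈ phi ↔ _; rw [hflip]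
    · rw [act_false_const_apply, hij, hnsg]; change ((2 : Fin 4), g (i, !sg)) ∈ phi ↔ _; rw [hflip]
    · rw [act_false_const_apply, hij, hnsg]; change ((3 : Fin 4), g (i, !sg)) ∈ phi ↔ _; rw [hflip]
  have key2 : ∀ x ∈ T, ((τ : ℂ →+* ℂ).comp x.2 ∈ (Φ₄ x.1).1 ↔ act (i' - i) false (c, c, c) (toPt e x) ∈ phi) := by
    intro x hx
    rw [key x]
    exact onface (toPt e x) (hT ▸ Finset.mem_image_of_mem _ hx)
  rw [ncard_sep_eq_card_filter, ncard_sep_eq_card_filter,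
    Finset.filter_congr fun x hx => key2 x hx, Finset.filter_congr fun x hx => (key2 x hx).not,
    card_filter_comp_eq_card_filter_image_of_injOn (toPt_injective e).injOn
      (fun y : Pt => act (i' - i) false (c, c, c) y ∈ phi),
    card_filter_comp_eq_card_filter_image_of_injOn (toPt_injective e).injOn
      (fun y : Pt => act (i' - i) false (c, c, c) y ∉ phi), hT]
  have hbal := (balanced_of_mem_gens ((mem_gens_iff _).2 (Or.inr ⟨i, sg, rfl⟩))).2
  rw [balanced₂₄, decide_eq_true_eq] at hbal
  exact hbal (i' - i, (c, c, c))

end Face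

/-! ## §2 HC in codimension 2 for `X₀ × X₁ × X₂ × X₃` implies the face hypothesis, hence everything -/

section CodimTwo

variable {K : Type} [Field K] [NumberField K] [IsCMField K] {N : ℕ} (κ : Fin N → Fin 4)
  {e : (K →+* ℂ) ≃ ZMod 3 × Bool}
  {A₄ : Fin 4 → AbelianVariety ℂ} {Φ₄ : Fin 4 → CMType K} {ι₄ : ∀ b : Fin 4, 𝓞 K →+* End (A₄ b)}
  {θ₄ : ∀ b : Fin 4, K →+* Module.End ℂ (complexBetti (A₄ b).X 1)}

/-- **HC²(`X₀ × X₁ × X₂ × X₃`) ⟹ the face hypothesis**: if every rational `(2,2)`-class of `Y = ⨁ A₄` is algebraic,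
then the weight line of every face weight is algebraic (it lies in `B²(Y) ⊗ ℂ` by Pohlmann's theorem, the face being
Galois-balanced). [cite: Pohlmann1968, Thm 1] [cite: GaoUllmo2025, Thm 3.1] -/
theorem hface_of_hodgeClasses_two (hA : ∀ b, IsCMTypeRealisation (Φ₄ b) (A₄ b) (ι₄ b) (θ₄ b))
    (he_conj : ∀ s : K →+* ℂ, e (ComplexEmbedding.conjugate s) = ((e s).1, !(e s).2))
    (hΦ : ∀ (b : Fin 4) (s : K →+* ℂ), s ∈ (Φ₄ b).1 ↔ ((b, (e s).1, (e s).2) : Pt) ∈ phi)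
    (h2 : ∀ c : complexBetti (⨁ A₄).X (2 * 2), IsRationalClass c →
      IsOfHodgeType (⨁ A₄).dim (⨁ A₄).X (2 * 2) 2 2 c → c ∈ algebraicClasses (⨁ A₄).X 2) :
    ∀ (i : ZMod 3) (sg : Bool) (T : Finset ((_ : Fin 4) × (K →+* ℂ))), T.image (toPt e) = face i sg →
      weightClassesAlg (K := fun _ : Fin 4 => K) A₄ ι₄ (2 * 2) T ≤ algebraicClasses (⨁ A₄).X 2 := by
  intro i sg T hT
  have hcard : T.card = 2 * 2 := by
    rw [← Finset.card_image_of_injective T (toPt_injective e), hT]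
    exact (gens_balanced.2 i sg).2.1
  have hS : T ∈ pohlmannSetsAlg (K := fun _ : Fin 4 => K) Φ₄ 2 :=
    ⟨hcard, isGaloisBalancedAlg_of_image_eq_face he_conj hΦ hT⟩
  refine (weightClassesAlg_le_hodgeClassSpan (K := fun _ : Fin 4 => K) hA hS).trans ?_
  exact Submodule.span_le.2 fun c hc => h2 c hc.1 hc.2

/-- **MAIN COROLLARY (frame form).  HC in codimension 2 for the 12-fold `X₀ × X₁ × X₂ × X₃` implies the Hodge
conjecture (all codimensions) for EVERY product of powers `⨁_j A₄ (κ j)` of the four CM threefolds of a pair-flip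
sextic CM field.** [cite: Pohlmann1968, Thm 1] [cite: GaoUllmo2025, Thm 3.1] [cite: Milne2020HodgeClassesAV, Thm. 1] -/
theorem hodgeConjectureFor_biproduct_comp_of_hodgeClasses_two
    (hA : ∀ b, IsCMTypeRealisation (Φ₄ b) (A₄ b) (ι₄ b) (θ₄ b))
    (he_conj : ∀ s : K →+* ℂ, e (ComplexEmbedding.conjugate s) = ((e s).1, !(e s).2))
    (he_gal : ∀ (j : ZMod 3) (fl : Bool × Bool × Bool), ∃ σ : ℂ ≃+* ℂ, ∀ s : K →+* ℂ,
      e ((σ : ℂ →+* ℂ).comp s) = ((e s).1 + j, xor (e s).2 (flipAt fl ((e s).1 + j))))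
    (hΦ : ∀ (b : Fin 4) (s : K →+* ℂ), s ∈ (Φ₄ b).1 ↔ ((b, (e s).1, (e s).2) : Pt) ∈ phi)
    (h2 : ∀ c : complexBetti (⨁ A₄).X (2 * 2), IsRationalClass c →
      IsOfHodgeType (⨁ A₄).dim (⨁ A₄).X (2 * 2) 2 2 c → c ∈ algebraicClasses (⨁ A₄).X 2) :
    HodgeConjectureFor (⨁ fun j => A₄ (κ j)).dim (⨁ fun j => A₄ (κ j)).X :=
  hodgeConjectureFor_biproduct_comp_of_faces κ hA he_conj he_gal hΦ (hface_of_hodgeClasses_two hA he_conj hΦ h2)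

/-- **The same for every abelian variety dominated by a product of powers** — in particular every abelian variety
isogenous to a product of powers of `X₀, …, X₃`: HC²(`X₀ × X₁ × X₂ × X₃`) ⟹ HC(`B`). [cite: Milne2020HodgeClassesAV, Thm. 1]
[cite: MumfordAV1970, §19] -/
theorem hodgeConjectureFor_of_avDominatedBy_comp_of_hodgeClasses_two
    (hA : ∀ b, IsCMTypeRealisation (Φ₄ b) (A₄ b) (ι₄ b) (θ₄ b))
    (he_conj : ∀ s : K →+* ℂ, e (ComplexEmbedding.conjugate s) = ((e s).1, !(e s).2))
    (he_gal : ∀ (j : ZMod 3) (fl : Bool × Bool × Bool), ∃ σ : ℂ ≃+* ℂ, ∀ s : K →+* ℂ,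
      e ((σ : ℂ →+* ℂ).comp s) = ((e s).1 + j, xor (e s).2 (flipAt fl ((e s).1 + j))))
    (hΦ : ∀ (b : Fin 4) (s : K →+* ℂ), s ∈ (Φ₄ b).1 ↔ ((b, (e s).1, (e s).2) : Pt) ∈ phi)
    (h2 : ∀ c : complexBetti (⨁ A₄).X (2 * 2), IsRationalClass c →
      IsOfHodgeType (⨁ A₄).dim (⨁ A₄).X (2 * 2) 2 2 c → c ∈ algebraicClasses (⨁ A₄).X 2)
    {B : AbelianVariety ℂ} (hB : Domination.AVDominatedBy B (⨁ fun j => A₄ (κ j))) :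
    HodgeConjectureFor B.dim B.X :=
  Domination.hodgeConjectureFor_of_avDominatedBy
    (hodgeConjectureFor_biproduct_comp_of_hodgeClasses_two κ hA he_conj he_gal hΦ h2) hB

/-- **Converse (sanity): HC² of `X₀ × X₁ × X₂ × X₃` is an instance of the conclusion** (`κ = id`, codimension 2),
so the reduction is an EQUIVALENCE «HC for all products of powers ⟺ HC²(`X₀ × X₁ × X₂ × X₃`)». [folklore] -/
theorem hodgeClasses_two_of_hodgeConjectureFor_biproduct (h : HodgeConjectureFor (⨁ A₄).dim (⨁ A₄).X) :
    ∀ c : complexBetti (⨁ A₄).X (2 * 2), IsRationalClass c →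
      IsOfHodgeType (⨁ A₄).dim (⨁ A₄).X (2 * 2) 2 2 c → c ∈ algebraicClasses (⨁ A₄).X 2 :=
  fun c hc hH => h.2 2 c hc hH

end CodimTwo

end Summit.HodgeConjecture.CorCM.PairFlipSexticFourCore

end
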